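import Literature.AnabelianGeometry.SemiGraphs.BTempQDPairQuotientConnected
import Literature.AnabelianGeometry.SemiGraphs.BTempQDPairCategoryPNonVacuity
import Literature.AnabelianGeometry.SemiGraphs.BTempQDPairZeroProper
import Literature.AnabelianGeometry.SemiGraphs.BTempStructureProofs
import Literature.AnabelianGeometry.SemiGraphs.QuasiTemperoidsQDPairsWeaklyConnected
import Literature.AnabelianGeometry.SemiGraphs.QuasiTemperoidsNondegenerateObj
import Literature.AnabelianGeometry.SemiGraphs.UniversalCoveringObj
import HarnessLib

/-!
# Semi-graphs of anabelioids, Appendix: the predicates of Definitions A.1 (ii) / A.3 (i) DECIDED at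
# the model temperoid `B^temp(Π)` — nondegenerate ⟺ has a point; weakly ⊋ strongly connected

Mochizuki, *Semi-graphs of anabelioids*, Publ. RIMS **42** (2006) 221–322, Appendix
"Quasi-temperoids", Definition A.1 (ii) p. 79 ("An object `A` of a quasi-temperoid `Q` will be called
*nondegenerate* if, for every connected object `B` of `Q`, there exist arrows `C → B`, `C → A`, for some
connected object `C` of `Q`") and Definition A.3 (i) p. 82 ("If `Γ_A` acts transitively on `π₀(A)`, then
we shall say that this QD-pair is *weakly connected*; if `A` is connected, then we shall say that this
QD-pair is *strongly connected*") [cite: MochizukiSemiAnbd2006, Def A.1(ii) p.79; Def A.3(i) p.82].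

PROOF-ONLY complement (abc-iut cell, D-0079 letter F, sub-cell [SemiAnbd]+[CombGC], pack E rows F-1614
`IsNondegenerateObj` / F-1630 `QDPair.IsWeaklyConnected`; seat abc-iut-L3-t1) to the named non-vacuity
instances of `QuasiTemperoidsPredicatesNonVacuity.lean` (abc-iut-L3-d3: `isNondegenerateObj_nonVacuity_*`,
`isWeaklyConnected_nonVacuity_*`, cited BY NAME, not restated).  Beyond inhabitation, both predicates are
DECIDED at the carrier `B^temp(Π)` (`Π` tempered, [SemiAnbd] §3 p. 33):

* Def. A.1 (ii): `BTemp.isNondegenerateObj_iff_nonempty` — an object of `B^temp(Π)` is nondegenerate iff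
  it has a point (Prop. A.2 (iii) for the one-member family, through the tree's
  `IsConnectedQuasiTemperoid.isNondegenerateObj_iff_isNonemptyObj` and `BTemp.isNonemptyObj_iff`); so
  `isNondegenerateObj_of_point`, the honest negative `not_isNondegenerateObj_of_isEmpty`, and — for ANY
  topological group — `isNondegenerateObj_punitObj` (the point is terminal);
* Def. A.3 (i): "weakly connected" is STRICTLY weaker than "strongly connected" at this carrier — the
  QD-pair `(pt ⊔ pt, Aut)` (two points, trivial `Π`-action, full automorphism group) is weakly connected
  (`QDPair.isWeaklyConnected_twoPointPair`: its quotient is one point, and "the quotient is connected iff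
  the QD-pair is weakly connected", the tree's `QDPair.isConnectedObj_orbitQuotient_iff`) but not strongly
  connected (`QDPair.not_isStronglyConnected_twoPointPair`); `exists_isWeaklyConnected_not_isStronglyConnected`.

No definition; elementary; nothing here refers to the IUT corpus or takes a side on [IUTchIII] Cor. 3.12.
-/

open CategoryTheory CategoryTheory.Limits

namespace Literature.AnabelianGeometry.SemiGraphs

open Literature.AlgebraicGeometry.Frobenioids (IsConnectedObj IsNonemptyObj)
open Literature.AlgebraicGeometry.Frobenioids.QuasiTemperoid.BTempConnected
  (exists_ρ_eq_of_isConnectedObj isConnectedObj_of_transitive isInitial_of_isEmpty)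

universe u

variable {G : Type u} [Group G] [TopologicalSpace G] [IsTopologicalGroup G]

/-! ### Definition A.1 (ii) decided at `B^temp(Π)`: nondegenerate ⟺ has a point -/

namespace BTemp

/-- **Def. A.1 (ii) at `B^temp(Π)`, `Π` tempered: an object is nondegenerate iff it has a point**
(`B^temp(Π)` is a connected quasi-temperoid, in which nondegenerate = non-empty, Prop. A.2 (iii); and an
object of `B^temp(Π)` is non-empty [non-initial] iff its underlying set is inhabited).
[cite: MochizukiSemiAnbd2006, Def A.1(ii) p.79] -/
theorem isNondegenerateObj_iff_nonempty (hG : IsTempered G) (X : BTemp G) :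
    IsNondegenerateObj X ↔ Nonempty X.obj.V :=
  ((QDPair.isConnectedQuasiTemperoid_bTemp hG).isNondegenerateObj_iff_isNonemptyObj X).trans
    (BTemp.isNonemptyObj_iff X)

/-- **Def. A.1 (ii) at `B^temp(Π)`, `Π` tempered**: every object with a point is nondegenerate.
[cite: MochizukiSemiAnbd2006, Def A.1(ii) p.79] -/
theorem isNondegenerateObj_of_point (hG : IsTempered G) (X : BTemp G) (x : X.obj.V) :
    IsNondegenerateObj X :=
  (isNondegenerateObj_iff_nonempty hG X).mpr ⟨x⟩

/-- **Def. A.1 (ii)**, the honest negative at the same carrier: an object of `B^temp(Π)` WITHOUT points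
(an empty = initial object) is not nondegenerate (`Π` tempered; Remark A.1.2).
[cite: MochizukiSemiAnbd2006, Rmk A.1.2 p.80] -/
theorem not_isNondegenerateObj_of_isEmpty (hG : IsTempered G) (E : BTemp G) (hE : IsEmpty E.obj.V) :
    ¬ IsNondegenerateObj E :=
  fun h => hE.false ((isNondegenerateObj_iff_nonempty hG E).mp h).some

omit [IsTopologicalGroup G] in
/-- **Def. A.1 (ii) at `B^temp(Π)` for ANY topological group `Π`** (no temperedness): the one-point object
is nondegenerate — every connected `B` receives `𝟙 : B → B` and maps to the (terminal) point.
[cite: MochizukiSemiAnbd2006, Def A.1(ii) p.79] -/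
theorem isNondegenerateObj_punitObj : IsNondegenerateObj (BTemp.punitObj : BTemp G) :=
  fun B hB => ⟨B, hB, ⟨𝟙 B⟩, ⟨BTemp.isTerminal_punitObj.from B⟩⟩

end BTemp

/-! ### Definition A.3 (i) at `B^temp(Π)`: weakly connected ⊋ strongly connected -/

namespace QDPair

/-- **"Weakly connected" is strictly weaker than "strongly connected" in `B^temp(Π)`** (`Π` tempered),
positive half: the QD-pair `(pt ⊔ pt, Aut(pt ⊔ pt))` — two points with the trivial `Π`-action and its
full automorphism group — is weakly connected: the swap automorphism identifies the two points, so the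
quotient `(pt ⊔ pt)/Aut` is a single point, hence connected, and "the quotient is connected iff the
QD-pair is weakly connected" (`QDPair.isConnectedObj_orbitQuotient_iff`).
[cite: MochizukiSemiAnbd2006, Def A.3(i) p.82] -/
theorem isWeaklyConnected_twoPointPair (hG : IsTempered G) :
    (⟨BTemp.trivialObj G (ULift.{u} Bool), ⊤⟩ : QDPair (BTemp G)).IsWeaklyConnected := by
  set P : QDPair (BTemp G) := ⟨BTemp.trivialObj G (ULift.{u} Bool), ⊤⟩ with hP
  rw [← QDPair.isConnectedObj_orbitQuotient_iff hG]
  -- the swap automorphism of the two-point object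
  let σ : Aut P.A := BTemp.isoOfEquiv (X := P.A) (Y := P.A)
    (Function.Involutive.toPerm (fun x : ULift.{u} Bool => ULift.up (!x.down))
      (fun x => by cases x; simp))
    (fun _ _ => rfl)
  have hpt : ∀ x : P.A.obj.V, P.orbitMk (ULift.up true) = P.orbitMk x := by
    intro x
    rw [QDPair.orbitMk_eq_iff]
    obtain ⟨b⟩ := x
    cases b
    · exact ⟨σ, Subgroup.mem_top σ, rfl⟩
    · exact ⟨1, Subgroup.mem_top _, rfl⟩
  refine isConnectedObj_of_transitive _ (P.orbitMk (ULift.up true)) fun q => ⟨1, ?_⟩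
  rw [map_one]
  obtain ⟨x, rfl⟩ := P.orbitMk_surjective q
  exact hpt x

omit [IsTopologicalGroup G] in
/-- **"Weakly connected" is strictly weaker than "strongly connected" in `B^temp(Π)`**, negative half:
the two-point object with the trivial action is NOT connected (it has two `Π`-orbits), so the QD-pair
`(pt ⊔ pt, Aut)` is not strongly connected. [cite: MochizukiSemiAnbd2006, Def A.3(i) p.82] -/
theorem not_isStronglyConnected_twoPointPair :
    ¬ (⟨BTemp.trivialObj G (ULift.{u} Bool), ⊤⟩ : QDPair (BTemp G)).IsStronglyConnected := by
  intro h
  obtain ⟨g, hg⟩ := exists_ρ_eq_of_isConnectedObj _ h (ULift.up true) (ULift.up false)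
  change ULift.up true = ULift.up false at hg
  cases hg

/-- **At `B^temp(Π)`, `Π` tempered, there is a weakly connected QD-pair that is not strongly connected**
(Def. A.3 (i) names two distinct notions at the genuine carrier). [cite: MochizukiSemiAnbd2006, Def A.3(i) p.82] -/
theorem exists_isWeaklyConnected_not_isStronglyConnected (hG : IsTempered G) :
    ∃ P : QDPair (BTemp G), P.IsWeaklyConnected ∧ ¬ P.IsStronglyConnected :=
  ⟨_, isWeaklyConnected_twoPointPair hG, not_isStronglyConnected_twoPointPair⟩

/-- Conversely every strongly connected QD-pair of `B^temp(Π)` is weakly connected (the tree's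
`IsStronglyConnected.isWeaklyConnected`, any category), so at this carrier the weakly connected pairs
STRICTLY contain the strongly connected ones. [cite: MochizukiSemiAnbd2006, Def A.3(i) p.82] -/
theorem isStronglyConnected_lt_isWeaklyConnected (hG : IsTempered G) :
    (fun P : QDPair (BTemp G) => P.IsStronglyConnected) < fun P => P.IsWeaklyConnected :=
  ⟨fun _ h => QDPair.IsStronglyConnected.isWeaklyConnected h, fun h =>
    not_isStronglyConnected_twoPointPair (h _ (isWeaklyConnected_twoPointPair hG))⟩

end QDPair

end Literature.AnabelianGeometry.SemiGraphs
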